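import Literature.AlgebraicGeometry.Resolution.FrobeniusClosedBasesLift
import Literature.AlgebraicGeometry.Resolution.ResidueFrobeniusClosedBasis
import HarnessLib

/-!
# Discharge of `Kuhlmann2010Lemma410` (Kuhlmann 2010, Lemma 4.10 with Lemma 4.7 and [K5] Thm. 10)

Topic: `Literature/AlgebraicGeometry/Resolution` (valued function fields). F.-V. Kuhlmann,
*Elimination of ramification I: The generalized stability theorem*, Trans. AMS 362 (2010) =
arXiv:1003.5678, **Lemma 4.10** (the case `char K = p` of Lemma 4.7: "The ring `R = K[F̄] ⊂ F`
satisfies properties (LFC1), (LFC2) and (LFC3)"), vendored as the named fact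
`Kuhlmann2010Lemma410` in `FrobeniusClosedBases.lean`, is DISCHARGED here by assembling the proved
layers:

* `exists_subfield_of_representatives` (`ResidueFieldRepresentatives.lean`) — the field of
  representatives of `K̄` in `K`;
* `exists_residueField_section` (`ResidueFieldEmbedding.lean`) — the embedding `F̄ → F` over the
  residue map with `F = (K.F̄)^h` (Lemma 4.10, first assertion);
* `exists_frobeniusClosed_residue_basis` (`ResidueFrobeniusClosedBasis.lean`) — a Frobenius-closed
  `K̄`-basis of `F̄` ([K5] Thm. 10, through the pole filtration of
  `Literature/FieldTheory/FunctionField`);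
* `exists_isLiftedFrobeniusClosedBasisRing` (`FrobeniusClosedBasesLift.lean`) — (LFC1)–(LFC3)
  for `R = K[F̄]` and the lifted basis (Lemma 4.10, second assertion).

Of the printed Lemma 4.10, the clauses "`K̄ = K ∩ F̄`" (beyond `ι(K̄) ⊆ K`) and "`K` is linearly
disjoint from `F̄` over `K̄`" are not vendored as such: what the consumer
(`IsLiftedFrobeniusClosedBasisRing`, hence Prop. 4.12) uses of them is the valuation independence
of the lifted basis over `K` (clause `valuation_le`), which is proved directly from the
`K̄`-linear independence of the residues.

## Sources

* F.-V. Kuhlmann, Trans. AMS 362 (2010) = arXiv:1003.5678, §4.2, Lemmas 4.7–4.10.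
* F.-V. Kuhlmann, Lect. Notes Log. 26 (2006) = arXiv:1003.5683, §5, Thm. 10.
-/

noncomputable section

namespace Literature.AlgebraicGeometry.Resolution

universe u

/-- **DISCHARGE of `Kuhlmann2010Lemma410`** (Kuhlmann 2010, Lemma 4.10 with Lemma 4.7 and [K5]
Thm. 10): for `(Ω, V)` algebraically closed with `char Ω = char Ωv = p`, `K ≤ Ω` an algebraically
closed subfield and `F` henselized inertially generated of rank one with a residue-transcendental
generator over `K`, there is a subring `R ⊆ F` with a lifting of a Frobenius-closed basis,
(LFC1)–(LFC3). PROVED: a Frobenius-closed `K̄`-basis of `F̄`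
(`exists_frobeniusClosed_residue_basis`) lifted along the section of the residue map
(`exists_isLiftedFrobeniusClosedBasisRing`). [cite: Kuhlmann2010, Lemma 4.10 (with Lemma 4.7); Kuhlmann2006, Thm. 10] -/
theorem Kuhlmann2010Lemma410_holds : Kuhlmann2010Lemma410.{u} := by
  intro Ω _ _ V p _ _ hp K F hK hF
  haveI : Fact p.Prime := ⟨hp⟩
  obtain ⟨ι', b, i₁, hbF, hb1, hbp, hli, hsp⟩ := exists_frobeniusClosed_residue_basis V p hK hF
  exact exists_isLiftedFrobeniusClosedBasisRing V p hK hF b hbF i₁ hb1 hbp hli hsp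

/-- **DISCHARGE of `Kuhlmann2010Prop41RTEqualChar`** (Kuhlmann 2010, Prop. 4.1 in the
residue-transcendental case of equal characteristic, i.e. Prop. 4.12): the printed proof
(`Kuhlmann2010Prop41RTEqualChar.of_parts`, `NormalDegreePDefectlessArtinSchreier.lean`) with its
two inputs discharged (`Kuhlmann2010Lemma410_holds`, `Kuhlmann2010HenselsLemma_holds`). PROVED.
[cite: Kuhlmann2010, Prop. 4.1 and Prop. 4.12] -/
theorem Kuhlmann2010Prop41RTEqualChar_holds : Kuhlmann2010Prop41RTEqualChar.{u} :=
  Kuhlmann2010Prop41RTEqualChar.of_parts Kuhlmann2010Lemma410_holds Kuhlmann2010HenselsLemma_holds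

end Literature.AlgebraicGeometry.Resolution
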